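import Summits.PneNP.PneNP.Theorems.SymmetryBudgetWindowCanoniserSoundB4
import Literature.Computability.Complexity.RandomOraclePHSipser

/-!
# Window canoniser, XXVIII: completeness, I — reached labels

Route `PneNP/SymmetryBudget`, dichotomy `WindowBarrier` (stmt-PneNP-2145) / `NoHiddenOrder` (stmt-PneNP-14781);
continuation of `…WindowCanoniserSoundB3.lean`.  A label is REACHED at time `t` (`WCan.Good L x t`) if its replay runs
unfrozen up to `t` and arrives there undead, within the depth bound, having selected at every earlier
individualisation step ONE vertex whose recorded height is the size of the branching cell minus one, with an
equitable arrival state and the BUDGET `(∏_{v ∈ X} (λ v + 1)) · lam(U, c_t) ≤ 2 ^ (12 n + scales n)` (`CGCanon.lam`,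
the chain product of the Corneil–Goldberg recursion, which bounds every chain of branching degrees).  Reached
labels are OK (`WCan.Good.okP`), admissible (`WCan.Good.mem_admSet`), and the root label is reached at time `0`
(`WCan.good_root`).
-/

-- `Summit.PneNP.PneNP.…` duplicates `PneNP` BY DESIGN (single-problem summit, D-0017 layout).
set_option linter.dupNamespace false

noncomputable section

namespace Summit.PneNP.PneNP.Theorems

namespace WCan

open Finset Literature.Computability.Complexity Literature.Computability.Complexity.CGCanon
  Literature.Combinatorics.SimpleGraph ColourRefinementScheme
open scoped Classical

variable {K r n : ℕ}

/-! ### Reached labels -/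

/-- The budget exponent `12 n + (log₂ n + 1)`. -/
def B₀ (n : ℕ) : ℕ := 12 * n + scales n

/-- **A label REACHED at time `t`.** -/
structure Good (L : RawLab n) (x : Fin (r + n) × Fin (r + n) → Bool) (t : ℕ) : Prop where
  /-- unfrozen before `t` -/
  nfz : ∀ s < t, ¬ frzP L (rs L x s)
  /-- arrived at `t` -/
  now : nowP L (rs L x t)
  /-- not dead at `t` -/
  ndead : (rs L x t).dead = false
  /-- depth bound -/
  tle : t ≤ L.X.card + (n - L.U.card)
  /-- one vertex selected at every earlier individualisation step, with the recorded height -/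
  sel : ∀ s < t, IsConn (G x) (rs L x s).W (rs L x s).c →
    ∃ y, selSet L (rs L x s) = {y} ∧ (L.lam y : ℕ) + 1 = (bigMinCell (rs L x s).W (rs L x s).c).card
  /-- equitable arrival state -/
  equi : IsEqui (G x) (rs L x t).W (rs L x t).c
  /-- the budget -/
  budget : (∏ v ∈ L.X, ((L.lam v : ℕ) + 1)) * CGCanon.lam (crRefiner n) (G x) L.U (rs L x t).c ≤ 2 ^ B₀ n
  /-- heights vanish off `X` -/
  lam0 : ∀ v, v ∉ L.X → L.lam v = 0

namespace Good

variable {L : RawLab n} {x : Fin (r + n) × Fin (r + n) → Bool} {t : ℕ} (g : Good L x t)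
include g

/-- The depth bound in absolute terms. -/
theorem t_le : t ≤ 2 * n := by
  have h1 : L.X.card ≤ n := (card_le_univ _).trans_eq (by simp)
  have := g.tle; omega

/-- Hence the arrival is before the last iteration. -/
theorem t_lt_T : t < T n := by have := g.t_le; rw [T]; omega

/-- `arr` is off before the arrival. -/
theorem arr_eq_false {s : ℕ} (hs : s ≤ t) : (rs L x s).arr = false := by
  rw [Bool.eq_false_iff]
  intro h
  obtain ⟨s', hs', hnow⟩ := (rs_arr_iff L x s).1 h
  exact g.nfz s' (by omega) (Or.inr (Or.inl hnow))

/-- `dead` is off up to the arrival. -/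
theorem dead_eq_false {s : ℕ} (hs : s ≤ t) : (rs L x s).dead = false := by
  rw [Bool.eq_false_iff]
  intro h
  have := rs_dead_mono L x hs h
  rw [g.ndead] at this; exact Bool.false_ne_true this

/-- **A reached label is OK.** -/
theorem okP : okP L x := by
  refine ⟨(rs_arr_iff L x (T n)).2 ⟨t, g.t_lt_T, g.now⟩, ?_⟩
  obtain ⟨-, -, -, hd, -⟩ := rs_frozen L x (t := t) (t' := T n) (Or.inr (Or.inl g.now)) g.t_lt_T.le
  rw [hd, g.ndead]

/-- The final state is the arrival state, frozen. -/
theorem finSt_eq : (finSt L x).W = L.U ∧ (finSt L x).c = (rs L x t).c ∧ (finSt L x).C = L.X := by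
  obtain ⟨hW, hc, hC, -, -⟩ := rs_frozen L x (t := t) (t' := T n) (Or.inr (Or.inl g.now)) g.t_lt_T.le
  exact ⟨hW.trans g.now.1, hc, hC.trans g.now.2⟩

/-- The arrival state agrees with the final state. -/
theorem stEq_finSt : StEq (rs L x t) (finSt L x) := by
  obtain ⟨hW, hc, -⟩ := g.finSt_eq
  refine ⟨by rw [hW, g.now.1], by rw [g.finSt_eq.2.2, g.now.2], fun u w => ?_⟩
  simp only [St.liftLT, hW, hc, g.now.1]

/-- What an undead unfrozen step certifies: two vertices, a selected vertex if connected, a possible section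
otherwise. -/
theorem facts_of_step {s : ℕ} (hs : s < t) :
    ¬ (rs L x s).W.card ≤ 1 ∧ (IsConn (G x) (rs L x s).W (rs L x s).c → (selSet L (rs L x s)).Nonempty) ∧
      (¬ IsConn (G x) (rs L x s).W (rs L x s).c → pokP L x (rs L x s)) := by
  have hd := g.dead_eq_false (s := s + 1) (by omega)
  have hf := g.nfz s hs
  rw [rs_succ] at hd
  simp only [step, Bool.or_eq_false_iff, decide_eq_false_iff_not, not_and, hf, not_false_eq_true, true_implies,
    not_or, not_not] at hd
  obtain ⟨-, h1, h2, h3⟩ := hd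
  exact ⟨h1, h2, h3⟩

/-! ### Admissibility -/

omit g in
/-- `∑ log₂ ≤ log₂ ∏` for positive factors. -/
theorem sum_log_le_log_prod {ι : Type*} (s : Finset ι) (f : ι → ℕ) (hf : ∀ i ∈ s, 1 ≤ f i) :
    ∑ i ∈ s, Nat.log 2 (f i) ≤ Nat.log 2 (∏ i ∈ s, f i) := by
  induction s using Finset.induction_on with
  | empty => simp
  | insert a s ha ih =>
    rw [sum_insert ha, prod_insert ha]
    have hf' : ∀ i ∈ s, 1 ≤ f i := fun i hi => hf i (mem_insert_of_mem hi)
    have h1 : 1 ≤ ∏ i ∈ s, f i := Finset.one_le_prod' fun i hi => hf' i hi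
    have h2 : 1 ≤ f a := hf a (mem_insert_self a s)
    calc Nat.log 2 (f a) + ∑ i ∈ s, Nat.log 2 (f i) ≤ Nat.log 2 (f a) + Nat.log 2 (∏ i ∈ s, f i) := by
          have := ih hf'; omega
      _ ≤ Nat.log 2 (f a * ∏ i ∈ s, f i) := Literature.Computability.Complexity.log_two_add_le_log_two_mul h2 h1

/-- **A reached label is admissible** once `K n` covers the budget exponent. -/
theorem mem_admSet (hK : B₀ n ≤ K * n) : L ∈ RawLab.admSet K n := by
  rw [RawLab.mem_admSet]
  refine ⟨g.lam0, ?_⟩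
  have h1 : ∀ v ∈ L.X, 1 ≤ (L.lam v : ℕ) + 1 := fun v _ => Nat.le_add_left 1 _
  have hlam : 1 ≤ CGCanon.lam (crRefiner n) (G x) L.U (rs L x t).c := one_le_lam _ _ _ _
  have hprod : ∏ v ∈ L.X, ((L.lam v : ℕ) + 1) ≤ 2 ^ B₀ n := by
    have := g.budget
    calc ∏ v ∈ L.X, ((L.lam v : ℕ) + 1) = (∏ v ∈ L.X, ((L.lam v : ℕ) + 1)) * 1 := (mul_one _).symm
      _ ≤ (∏ v ∈ L.X, ((L.lam v : ℕ) + 1)) * CGCanon.lam (crRefiner n) (G x) L.U (rs L x t).c := Nat.mul_le_mul_left _ hlam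
      _ ≤ 2 ^ B₀ n := this
  calc ∑ v ∈ L.X, Nat.log 2 ((L.lam v : ℕ) + 1) ≤ Nat.log 2 (∏ v ∈ L.X, ((L.lam v : ℕ) + 1)) := sum_log_le_log_prod _ _ h1
    _ ≤ Nat.log 2 (2 ^ B₀ n) := Nat.log_mono_right hprod
    _ = B₀ n := Nat.log_pow (by norm_num) _
    _ ≤ K * n := hK

end Good

/-! ### The root -/

/-- The root label `(univ, ∅, 0)`. -/
def rootLab (n : ℕ) : RawLab n := ⟨univ, ∅, fun _ => 0⟩

/-- **The root label is reached at time `0`.** -/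
theorem good_root (x : Fin (r + n) × Fin (r + n) → Bool) : Good (rootLab n) x 0 := by
  refine ⟨fun s hs => absurd hs (Nat.not_lt_zero _), ⟨rfl, rfl⟩, rfl, Nat.zero_le _, fun s hs => absurd hs (Nat.not_lt_zero _),
    ?_, ?_, fun v _ => rfl⟩
  · show IsEqui (G x) univ (crRefine (G x) univ fun _ => 0)
    exact crRefine_isEqui
  · show (∏ v ∈ (∅ : Finset (Fin n)), ((0 : Fin (n + 1)) + 1 : ℕ)) * CGCanon.lam (crRefiner n) (G x) univ (crRefine (G x) univ fun _ => 0) ≤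
      2 ^ B₀ n
    rw [prod_empty, one_mul, ← crRefiner_refine]
    refine (lam_le_of_isEqui (crRefiner n) (G x) univ _ ((crRefiner n).isEqui _ _ _)).trans (Nat.pow_le_pow_right two_pos ?_)
    exact Nat.add_le_add_right (bud_le _ _) _

variable [NeZero n]

omit [NeZero n] in
/-- The budget exponent fits `16 n`. -/
theorem B₀_le (hn : 1 ≤ n) : B₀ n ≤ 16 * n := by
  rw [B₀, scales]
  have := Nat.log_lt_self 2 (x := n) (by omega)
  omega

end WCan

end Summit.PneNP.PneNP.Theorems

end
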